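import Literature.AnabelianGeometry.SemiGraphs.SubdivisionFiniteBalls
import Literature.AnabelianGeometry.SemiGraphs.TemperedLevelData
import Literature.AnabelianGeometry.SemiGraphs.TreeSystemFixedPoint
import Literature.AnabelianGeometry.SemiGraphs.FreeGroupsAndActionsProofs2
import HarnessLib

/-!
# [SemiAnbd] Thm 3.7 (iii), first sentence, over level data: PERSISTENT ⇒ VERTICIAL, and ESCAPE
# «a subgroup in no verticial subgroup has fixed loci leaving every finite set of base vertices»

Mochizuki, *Semi-graphs of anabelioids*, Publ. RIMS **42** (2006), §3, Theorem 3.7 (iii), author's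
manuscript pp. 40–41 [cite: MochizukiSemiAnbd2006, Thm 3.7(iii) pp.40-41]: "any compact subgroup of
`π₁^temp(𝒢)` is contained in at least one verticial subgroup"; proof p. 41: "`H` fixes at least one vertex
of `𝒢_{∞,i}` … by possibly replacing `J` by some smaller cofinal subset, we may assume that there exists a
compatible system of vertices of `𝒢_{∞,j}`, for `j ∈ J`, each of which is fixed by `H`".

PROOF-ONLY file (cell abc-iut, layer L3, GAP row G-t6g3-2 «Thm 3.7 (iii) beyond finite `𝔾`»; seat
abc-iut-L3-t8 gen 6, row «PERSISTENT⇒VERTICIAL / ESCAPE-DICHOTOMY» = item (D) of the desk memo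
HOME/staging/L3/L3-t8/g5/G2-CHARACTERISATION-L3t8g5.md; no definition).  At the countermodel `𝒢_θ`
(abc-iut-L3-d1, abc-iut-L3-d4: `ThetaRayRefutation.lean`) the existence sentence fails; abc-iut-w6-d062
proved it at every locally finite `𝒢` for ANCHORED compact subgroups (`TemperedAnchoredCompactOfLocallyFinite.lean`)
and isolated the residual as the anchor-free compact subgroups; abc-iut-w6-d066 (row T37iii·LOCFIN-PERSIST,
`TemperedCompactInVerticialAtOfPersistentLocFin.lean`, THEOREM OF RECORD `hfix_temperedPiChart_of_persistent_locFin`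
/ `compactInVerticialAt_of_locallyFinite_of_persistent` / `compactInVerticialAt_or_horizontalEscape`) proved,
for COMPACT `C ≠ 1` at a locally finite `𝔾`, that a persistent base vertex yields a compatible fixed system
(route: levels, immersions, finite level fibres, (I4′)_cpt).  This file is an INDEPENDENT SECOND ROUTE to
the persistence criterion with a different statement shape — NO COMPACTNESS of `C` (any subgroup), binders
(LE_C,w) + finite stars only (no levels / immersions / fibres / (I4′)_cpt), a CONFINEMENT lemma without
reference system, and the per-subgroup finite-set ESCAPE form — over abstract level data
`D : VerticialLevelData 𝒢 c`, under three binders discharged at the canonical tower of a locally finite `𝒢`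
in the companion file `TemperedPersistentCompactOfLocallyFinite.lean`: the local level-estrangement (LE_C,w)
of `TemperedHbddOfLocalLevelEstrangement.lean` (abc-iut-w6-d062), finite stars of the trees `hlocfin`
(abc-iut-w6-d120), finite stars of base vertices.

* `exists_level_forall_fixed_dist_le_four_of_over` — CONFINEMENT WITHOUT A REFERENCE SYSTEM: for a base
  vertex `u` with finite star, every level `j` has a deeper level `k` such that for ANY `C`-fixed vertex `y`
  of `𝒢_{∞,k}` over `u`, EVERY `C`-fixed vertex of `𝒢_{∞,k}` projects into `𝒢_{∞,j}` within subdivision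
  distance `4` of the image of `y` (one folding, `SemiGraph.vertexMap_eq_or_eq_of_folding`, at a level
  beyond the (LE)-levels of `u` and of ALL its star-neighbours; abc-iut-w6-d062's
  `exists_level_forall_fixed_dist_le_four` needs a compatible `C`-fixed system instead);
* `exists_fixedSystem_of_persistent` — **PERSISTENT ⇒ a compatible fixed system**: if ONE base vertex `u`
  carries a `C`-fixed vertex of `𝒢_{∞,k}` at EVERY level `k`, then `C` fixes a compatible system of tree
  vertices (for each `j` the images of the deeper fixed loci form a directed family of nonempty sets inside
  ONE finite ball — `SemiGraph.finite_setOf_vertex_dist_le` —; a member of minimal cardinality lies in all of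
  them; Kőnig, `SemiGraph.exists_compatible_of_finite`); hence, by (I2), `exists_verticial_ge_of_persistent`:
  **`C` lies in a verticial subgroup** — no compactness of `C` assumed; converse `exists_persistent_of_le_verticial`
  by (I1);
* `exists_persistent_of_finite` — a finite set of base vertices met by the fixed loci at every level contains
  a persistent vertex; `exists_level_forall_not_fixed_of_forall_not_le` — **ESCAPE**: if `C` lies in no
  verticial subgroup, then for every FINITE set `S` of base vertices some level carries no `C`-fixed vertex
  over `S`.

Nothing here asserts the existence sentence for all compact subgroups (false at `𝒢_θ`); nothing here bears
on [IUTchIII] Cor. 3.12; typed ≠ proved elsewhere.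
-/

namespace Literature.AnabelianGeometry.SemiGraphs

open CategoryTheory Topology

universe v u

namespace ProfiniteSemiGraph

namespace VerticialLevelData

variable {𝒢 : ProfiniteSemiGraph.{u}} {c : TemperedPiChart 𝒢} (D : VerticialLevelData.{v} 𝒢 c)

/-- The first step of a subdivision walk between the points of two distinct vertices is a branch at the
origin. [cite: MochizukiSemiAnbd2006, §1 pp.11-12] -/
private theorem exists_first_branch {T : SemiGraph.{u}} {y y' : T.Vertex} (hne : y ≠ y')
    (p : T.subdivision.Walk (Sum.inl y) (Sum.inl y')) :
    ∃ β : T.Branch, T.abuts β = some y ∧ (Sum.inr (Sum.inr β) : T.Node) ∈ p.support := by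
  cases p with
  | nil => exact (hne rfl).elim
  | cons h q =>
    obtain ⟨β, hβ, hq⟩ := (T.subdivision_adj_inl_iff y _).1 h
    subst hq
    exact ⟨β, hβ, by simp⟩

/-- Base vertices along the transition maps. [cite: MochizukiSemiAnbd2006, Thm 3.7(iii) p.41] -/
private theorem proj_eq_proj_trans ⦃j k : D.J⦄ (h : j ≤ k) (v : (D.tree k).Vertex) :
    (D.proj k).vertexMap v = (D.proj j).vertexMap ((D.trans h).vertexMap v) := by
  have e := congrArg (fun φ => SemiGraph.Hom.vertexMap φ v) (D.trans_over h)
  simpa only [SemiGraph.comp_vertexMap, Function.comp_apply] using e.symm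

/-- Fixed vertices go to fixed vertices under the transition maps.
[cite: MochizukiSemiAnbd2006, Thm 3.7(iii) p.41] -/
private theorem fixed_trans (C : Subgroup c.G) ⦃i j : D.J⦄ (h : i ≤ j) (z : (D.tree j).Vertex)
    (hz : ∀ g ∈ C, (D.act j g).hom.vertexMap z = z) :
    ∀ g ∈ C, (D.act i g).hom.vertexMap ((D.trans h).vertexMap z) = (D.trans h).vertexMap z := by
  intro g hg
  rw [← D.trans_act_vertexMap h g z, hz g hg]

/-- **CONFINEMENT WITHOUT A REFERENCE SYSTEM** ([SemiAnbd] Thm 3.7 (iii) p. 41, the sub-joint folding step,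
localised at ONE base vertex): let (LE_C,w) hold at every base vertex, and let `u` be a base vertex whose
closed star meets finitely many vertices.  Then every level `j` has a level `k ≥ j` such that for ANY
`C`-fixed vertex `y` of `𝒢_{∞,k}` over `u`, EVERY `C`-fixed vertex `z` of `𝒢_{∞,k}` maps into `𝒢_{∞,j}`
within subdivision distance `4` of the image of `y`: the first branch of the `C`-fixed geodesic `y → z`
maps to an edge `ε` at the image of `y`, whose far end lies over `u` or over a neighbour of `u`; `k` lies
beyond the (LE)-levels of all these finitely many base vertices, so the geodesic folds into `ε`
(`SemiGraph.vertexMap_eq_or_eq_of_folding`). [cite: MochizukiSemiAnbd2006, Thm 3.7(iii) p.41] -/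
theorem exists_level_forall_fixed_dist_le_four_of_over (C : Subgroup c.G)
    (hLE : ∀ (w : 𝒢.graph.Vertex) (j : D.J), ∃ (k : D.J) (hjk : j ≤ k), ∀ (k' : D.J) (hkk' : k ≤ k')
      (v : (D.tree k').Vertex), (D.proj k').vertexMap v = w →
      ∀ (b b' : (D.tree k').Branch), (D.tree k').abuts b = some v → (D.tree k').abuts b' = some v →
      (D.tree k').edgeOf b ≠ (D.tree k').edgeOf b' →
      (∀ g ∈ C, (D.act k' g).hom.edgeMap ((D.tree k').edgeOf b) = (D.tree k').edgeOf b) →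
      (∀ g ∈ C, (D.act k' g).hom.edgeMap ((D.tree k').edgeOf b') = (D.tree k').edgeOf b') →
      (D.trans (hjk.trans hkk')).edgeMap ((D.tree k').edgeOf b) =
        (D.trans (hjk.trans hkk')).edgeMap ((D.tree k').edgeOf b'))
    (u : 𝒢.graph.Vertex)
    (hu : {w : 𝒢.graph.Vertex | ∃ b b' : 𝒢.graph.Branch, 𝒢.graph.edgeOf b = 𝒢.graph.edgeOf b' ∧
      𝒢.graph.abuts b = some u ∧ 𝒢.graph.abuts b' = some w}.Finite)
    (j : D.J) :
    ∃ (k : D.J) (hjk : j ≤ k), ∀ y : (D.tree k).Vertex, (D.proj k).vertexMap y = u →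
      (∀ g ∈ C, (D.act k g).hom.vertexMap y = y) →
      ∀ z : (D.tree k).Vertex, (∀ g ∈ C, (D.act k g).hom.vertexMap z = z) →
        (D.tree j).subdivision.dist (Sum.inl ((D.trans hjk).vertexMap y))
          (Sum.inl ((D.trans hjk).vertexMap z)) ≤ 4 := by
  classical
  -- the (LE)-level at `u`, and one level beyond the (LE)-levels of the finitely many star-neighbours of `u`
  obtain ⟨k₀, hjk₀, h₀⟩ := hLE u j
  set S : Set 𝒢.graph.Vertex := {w : 𝒢.graph.Vertex | ∃ b b' : 𝒢.graph.Branch,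
    𝒢.graph.edgeOf b = 𝒢.graph.edgeOf b' ∧ 𝒢.graph.abuts b = some u ∧ 𝒢.graph.abuts b' = some w} with hS
  have hk : ∀ w : S, ∃ k : D.J, ∃ hjk : j ≤ k, ∀ (k' : D.J) (hkk' : k ≤ k')
      (v : (D.tree k').Vertex), (D.proj k').vertexMap v = w →
      ∀ (b b' : (D.tree k').Branch), (D.tree k').abuts b = some v → (D.tree k').abuts b' = some v →
      (D.tree k').edgeOf b ≠ (D.tree k').edgeOf b' →
      (∀ g ∈ C, (D.act k' g).hom.edgeMap ((D.tree k').edgeOf b) = (D.tree k').edgeOf b) →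
      (∀ g ∈ C, (D.act k' g).hom.edgeMap ((D.tree k').edgeOf b') = (D.tree k').edgeOf b') →
      (D.trans (hjk.trans hkk')).edgeMap ((D.tree k').edgeOf b) =
        (D.trans (hjk.trans hkk')).edgeMap ((D.tree k').edgeOf b') := fun w => hLE w j
  choose kf hjkf hkf using hk
  haveI : Finite S := hu.to_subtype
  obtain ⟨K, hK⟩ := (Set.finite_range kf).bddAbove
  obtain ⟨k₁, hk₀k₁, hKk₁⟩ := exists_ge_ge k₀ K
  have hjk₁ : j ≤ k₁ := hjk₀.trans hk₀k₁
  refine ⟨k₁, hjk₁, fun y hyu hfy z hfz => ?_⟩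
  by_cases hzy : z = y
  · rw [hzy, SimpleGraph.dist_self]
    exact Nat.zero_le _
  -- the `C`-fixed points of level `k₁` and the `C`-fixed geodesic from `y` to `z`
  let F : Set (D.tree k₁).Node := {n | ∀ g ∈ C, SemiGraph.nodeMap (D.act k₁ g) n = n}
  have hT := (D.isTree k₁).isTree
  let p : (D.tree k₁).subdivision.Path (Sum.inl y) (Sum.inl z) :=
    (hT.connected (Sum.inl y) (Sum.inl z)).some.toPath
  have hp : ∀ n ∈ p.1.support, n ∈ F := by
    intro n hn g hg
    have hyn : SemiGraph.nodeMap (D.act k₁ g) (Sum.inl y) = Sum.inl y := by simp [hfy g hg]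
    have hzn : SemiGraph.nodeMap (D.act k₁ g) (Sum.inl z) = Sum.inl z := by simp [hfz g hg]
    exact SemiGraph.nodeMap_eq_self_of_isPath hT.isAcyclic _ hyn hzn p.1 p.2 n hn
  -- fixed branch-points have fixed edges
  have hFedge : ∀ β : (D.tree k₁).Branch, (Sum.inr (Sum.inr β) : (D.tree k₁).Node) ∈ F →
      ∀ g ∈ C, (D.act k₁ g).hom.edgeMap ((D.tree k₁).edgeOf β) = (D.tree k₁).edgeOf β := by
    intro β hβ g hg
    have h := hβ g hg
    simp only [SemiGraph.nodeMap_inr_inr, Sum.inr.injEq] at h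
    rw [← (D.act k₁ g).hom.edgeOf_branchMap β, h]
  -- the first branch `β` at `y`, its image edge `ε` at the image `ȳ` of `y`, the far end `a'` of `ε`
  obtain ⟨β, hβ, hβF⟩ := exists_first_branch (fun h => hzy h.symm) p.1
  have hc₀ε : (D.tree j).edgeOf ((D.trans hjk₁).branchMap β) =
      (D.trans hjk₁).edgeMap ((D.tree k₁).edgeOf β) := (D.trans hjk₁).edgeOf_branchMap β
  have hc₀a : (D.tree j).abuts ((D.trans hjk₁).branchMap β) = some ((D.trans hjk₁).vertexMap y) :=
    (D.trans hjk₁).abuts_branchMap β _ hβ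
  obtain ⟨a', hends, hdist, hprov⟩ :=
    SemiGraph.exists_ends_dist_le_four' ((D.trans hjk₁).edgeMap ((D.tree k₁).edgeOf β)) _ hc₀ε hc₀a
  -- base vertices: `ȳ` lies over `u`, `a'` over `u` or over a star-neighbour of `u`
  have hyu' : (D.proj j).vertexMap ((D.trans hjk₁).vertexMap y) = u := by
    rw [← D.proj_eq_proj_trans hjk₁, hyu]
  have ha'S : (D.proj j).vertexMap a' = u ∨ (D.proj j).vertexMap a' ∈ S := by
    rcases hprov with h | ⟨c', hc'ε, hc'a⟩
    · exact Or.inl (by rw [h, hyu'])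
    · refine Or.inr ⟨(D.proj j).branchMap ((D.trans hjk₁).branchMap β), (D.proj j).branchMap c', ?_, ?_, ?_⟩
      · rw [(D.proj j).edgeOf_branchMap, (D.proj j).edgeOf_branchMap, hc₀ε, hc'ε]
      · rw [(D.proj j).abuts_branchMap _ _ hc₀a, hyu']
      · exact (D.proj j).abuts_branchMap _ _ hc'a
  -- FOLD along the transition to level `j`
  have hfold := SemiGraph.vertexMap_eq_or_eq_of_folding (D.trans hjk₁) F hends ?_ p.1 hp
    (Or.inl rfl) β (hp _ hβF) hβ rfl
  · rcases hfold with h | h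
    · rw [h, SimpleGraph.dist_self]
      exact Nat.zero_le _
    · rw [h]
      exact hdist
  · -- the folding hypothesis at tree vertices mapping to `ȳ` (over `u`) or to `a'` (over `u` or `w ∈ S`)
    intro v _ hv β₁ β₂ hβ₁F hβ₂F hβ₁v hβ₂v
    by_cases hee : (D.tree k₁).edgeOf β₁ = (D.tree k₁).edgeOf β₂
    · rw [hee]
    have hvw : (D.proj k₁).vertexMap v = u ∨ (D.proj k₁).vertexMap v ∈ S := by
      rcases hv with hv | hv
      · exact Or.inl (by rw [D.proj_eq_proj_trans hjk₁, hv, hyu'])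
      · rw [D.proj_eq_proj_trans hjk₁, hv]
        exact ha'S
    rcases hvw with hvu | hvS
    · exact h₀ k₁ hk₀k₁ v hvu β₁ β₂ hβ₁v hβ₂v hee (hFedge β₁ hβ₁F) (hFedge β₂ hβ₂F)
    · have hle : kf ⟨_, hvS⟩ ≤ k₁ := (hK ⟨⟨_, hvS⟩, rfl⟩).trans hKk₁
      exact hkf ⟨_, hvS⟩ k₁ hle v rfl β₁ β₂ hβ₁v hβ₂v hee (hFedge β₁ hβ₁F) (hFedge β₂ hβ₂F)

/-- **PERSISTENT ⇒ A COMPATIBLE FIXED SYSTEM** ([SemiAnbd] Thm 3.7 (iii) p. 41 "we may assume that there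
exists a compatible system of vertices of `𝒢_{∞,j}` … each of which is fixed by `H`", at an infinite but
locally finite base): under (LE_C,w) everywhere and finite stars of the trees, if some base vertex `u` with
finite star carries a `C`-fixed vertex of `𝒢_{∞,k}` at EVERY level `k`, then `C` fixes a compatible system
of tree vertices.  For each `j`, the images in `𝒢_{∞,j}` of the fixed loci of the levels `k ≥ j` form a
directed decreasing family of nonempty sets which, from the confinement level on, lie in ONE finite ball;
a member of minimal cardinality is contained in all members, so the set `F j` of fixed vertices of
`𝒢_{∞,j}` lying in every such image is finite and nonempty; these sets are stable under the transition
maps, and Kőnig's lemma (`SemiGraph.exists_compatible_of_finite`) gives the compatible system.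
[cite: MochizukiSemiAnbd2006, Thm 3.7(iii) p.41] -/
theorem exists_fixedSystem_of_persistent (C : Subgroup c.G)
    (hLE : ∀ (w : 𝒢.graph.Vertex) (j : D.J), ∃ (k : D.J) (hjk : j ≤ k), ∀ (k' : D.J) (hkk' : k ≤ k')
      (v : (D.tree k').Vertex), (D.proj k').vertexMap v = w →
      ∀ (b b' : (D.tree k').Branch), (D.tree k').abuts b = some v → (D.tree k').abuts b' = some v →
      (D.tree k').edgeOf b ≠ (D.tree k').edgeOf b' →
      (∀ g ∈ C, (D.act k' g).hom.edgeMap ((D.tree k').edgeOf b) = (D.tree k').edgeOf b) →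
      (∀ g ∈ C, (D.act k' g).hom.edgeMap ((D.tree k').edgeOf b') = (D.tree k').edgeOf b') →
      (D.trans (hjk.trans hkk')).edgeMap ((D.tree k').edgeOf b) =
        (D.trans (hjk.trans hkk')).edgeMap ((D.tree k').edgeOf b'))
    (hlocfin : ∀ (j : D.J) (x : (D.tree j).Vertex), {b : (D.tree j).Branch | (D.tree j).abuts b = some x}.Finite)
    (u : 𝒢.graph.Vertex)
    (hu : {w : 𝒢.graph.Vertex | ∃ b b' : 𝒢.graph.Branch, 𝒢.graph.edgeOf b = 𝒢.graph.edgeOf b' ∧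
      𝒢.graph.abuts b = some u ∧ 𝒢.graph.abuts b' = some w}.Finite)
    (hpers : ∀ k : D.J, ∃ y : (D.tree k).Vertex, (D.proj k).vertexMap y = u ∧
      ∀ g ∈ C, (D.act k g).hom.vertexMap y = y) :
    ∃ x : ∀ j, (D.tree j).Vertex, (∀ ⦃i j : D.J⦄ (h : i ≤ j), (D.trans h).vertexMap (x j) = x i) ∧
      ∀ g ∈ C, ∀ j, (D.act j g).hom.vertexMap (x j) = x j := by
  classical
  -- fixed vertices, and the images of the fixed loci of deeper levels
  let Fix : ∀ j : D.J, Set (D.tree j).Vertex := fun j => {z | ∀ g ∈ C, (D.act j g).hom.vertexMap z = z}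
  let Img : ∀ (j k : D.J), j ≤ k → Set (D.tree j).Vertex := fun j k h => (D.trans h).vertexMap '' Fix k
  have hImg_anti : ∀ (j k k' : D.J) (h : j ≤ k) (h' : j ≤ k') (hkk' : k ≤ k'), Img j k' h' ⊆ Img j k h := by
    rintro j k k' h h' hkk' _ ⟨w, hw, rfl⟩
    exact ⟨(D.trans hkk').vertexMap w, D.fixed_trans C hkk' w hw, D.trans_vertexMap_comp h hkk' w⟩
  -- the persistent fixed vertices of level `j`
  let F : ∀ j : D.J, Set (D.tree j).Vertex := fun j => {z | z ∈ Fix j ∧ ∀ (k : D.J) (h : j ≤ k), z ∈ Img j k h}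
  have hmap : ∀ ⦃i j : D.J⦄ (h : i ≤ j) (z : (D.tree j).Vertex), z ∈ F j → (D.trans h).vertexMap z ∈ F i := by
    intro i j h z hz
    refine ⟨D.fixed_trans C h z hz.1, fun k hik => ?_⟩
    obtain ⟨k', hjk', hkk'⟩ := exists_ge_ge j k
    obtain ⟨w, hw, hwz⟩ := hz.2 k' hjk'
    refine ⟨(D.trans hkk').vertexMap w, D.fixed_trans C hkk' w hw, ?_⟩
    rw [D.trans_vertexMap_comp, ← hwz, D.trans_vertexMap_comp]
  -- finiteness and nonemptiness of `F j`, from confinement in one finite ball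
  have hfin_ne : ∀ j : D.J, (F j).Finite ∧ (F j).Nonempty := by
    intro j
    obtain ⟨k, hjk, hconf⟩ := D.exists_level_forall_fixed_dist_le_four_of_over C hLE u hu j
    obtain ⟨y, hyu, hfy⟩ := hpers k
    let B : Set (D.tree j).Vertex :=
      {z | (D.tree j).subdivision.dist (Sum.inl ((D.trans hjk).vertexMap y)) (Sum.inl z) ≤ 4}
    have hBfin : B.Finite :=
      SemiGraph.finite_setOf_vertex_dist_le (D.isTree j).isTree.connected (hlocfin j) _ 4
    have hImgB : ∀ (k' : D.J) (hkk' : k ≤ k'), Img j k' (hjk.trans hkk') ⊆ B := by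
      rintro k' hkk' _ ⟨w, hw, rfl⟩
      have h := hconf y hyu hfy ((D.trans hkk').vertexMap w) (D.fixed_trans C hkk' w hw)
      rw [D.trans_vertexMap_comp] at h
      exact h
    have hImgne : ∀ (k' : D.J) (h' : j ≤ k'), (Img j k' h' ∩ B).Nonempty := by
      intro k' h'
      obtain ⟨k'', hk'k'', hkk''⟩ := exists_ge_ge k' k
      obtain ⟨y'', -, hfy''⟩ := hpers k''
      have hmem : (D.trans (hjk.trans hkk'')).vertexMap y'' ∈ Img j k'' (hjk.trans hkk'') := ⟨y'', hfy'', rfl⟩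
      exact ⟨_, hImg_anti j k' k'' h' (hjk.trans hkk'') hk'k'' hmem, hImgB k'' hkk'' hmem⟩
    refine ⟨hBfin.subset fun z hz => hImgB k le_rfl (hz.2 k hjk), ?_⟩
    -- a member of minimal cardinality of the directed family `Img j k' ∩ B`
    have hP : ∃ n : ℕ, ∃ (k' : D.J) (h' : j ≤ k'), (Img j k' h' ∩ B).ncard = n := ⟨_, j, le_rfl, rfl⟩
    obtain ⟨k₁, hjk₁, hk₁⟩ := Nat.find_spec hP
    have hmin : ∀ (k' : D.J) (h' : j ≤ k'), (Img j k₁ hjk₁ ∩ B).ncard ≤ (Img j k' h' ∩ B).ncard := by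
      intro k' h'
      rw [hk₁]
      exact Nat.find_min' hP ⟨k', h', rfl⟩
    have hall : ∀ (k' : D.J) (h' : j ≤ k'), Img j k₁ hjk₁ ∩ B ⊆ Img j k' h' := by
      intro k' h'
      obtain ⟨k'', hk₁k'', hk'k''⟩ := exists_ge_ge k₁ k'
      have hsub : Img j k'' (hjk₁.trans hk₁k'') ∩ B ⊆ Img j k₁ hjk₁ ∩ B :=
        Set.inter_subset_inter_left _ (hImg_anti j k₁ k'' hjk₁ _ hk₁k'')
      have heq : Img j k'' (hjk₁.trans hk₁k'') ∩ B = Img j k₁ hjk₁ ∩ B :=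
        Set.eq_of_subset_of_ncard_le hsub (hmin k'' _) (hBfin.subset Set.inter_subset_right)
      rw [← heq]
      exact Set.inter_subset_left.trans (hImg_anti j k' k'' h' _ hk'k'')
    obtain ⟨z, hz⟩ := hImgne k₁ hjk₁
    refine ⟨z, ?_, fun k' h' => hall k' h' hz⟩
    obtain ⟨w, hw, hwz⟩ := hz.1
    rw [← hwz]
    exact D.fixed_trans C hjk₁ w hw
  obtain ⟨x, hxF, hcompat⟩ := SemiGraph.exists_compatible_of_finite
    (X := fun j => (D.tree j).Vertex) (fun i j h => (D.trans h).vertexMap)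
    (fun i x => D.trans_vertexMap_refl i x) (fun i j k hij hjk x => D.trans_vertexMap_comp hij hjk x)
    F (fun j => (hfin_ne j).1) (fun j => (hfin_ne j).2) hmap
  exact ⟨x, hcompat, fun g hg j => (hxF j).1 g hg⟩

/-- **PERSISTENT ⇒ VERTICIAL** ([SemiAnbd] Thm 3.7 (iii) p. 41, first sentence, localised): under (LE_C,w)
everywhere and finite stars of the trees, a subgroup `C` (not assumed compact) admitting ONE base vertex
`u` with finite star over which `C` fixes a vertex of `𝒢_{∞,k}` at every level `k` is contained in a
verticial subgroup (`exists_fixedSystem_of_persistent` and (I2)). [cite: MochizukiSemiAnbd2006, Thm 3.7(iii) pp.40-41] -/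
theorem exists_verticial_ge_of_persistent (C : Subgroup c.G)
    (hLE : ∀ (w : 𝒢.graph.Vertex) (j : D.J), ∃ (k : D.J) (hjk : j ≤ k), ∀ (k' : D.J) (hkk' : k ≤ k')
      (v : (D.tree k').Vertex), (D.proj k').vertexMap v = w →
      ∀ (b b' : (D.tree k').Branch), (D.tree k').abuts b = some v → (D.tree k').abuts b' = some v →
      (D.tree k').edgeOf b ≠ (D.tree k').edgeOf b' →
      (∀ g ∈ C, (D.act k' g).hom.edgeMap ((D.tree k').edgeOf b) = (D.tree k').edgeOf b) →
      (∀ g ∈ C, (D.act k' g).hom.edgeMap ((D.tree k').edgeOf b') = (D.tree k').edgeOf b') →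
      (D.trans (hjk.trans hkk')).edgeMap ((D.tree k').edgeOf b) =
        (D.trans (hjk.trans hkk')).edgeMap ((D.tree k').edgeOf b'))
    (hlocfin : ∀ (j : D.J) (x : (D.tree j).Vertex), {b : (D.tree j).Branch | (D.tree j).abuts b = some x}.Finite)
    (u : 𝒢.graph.Vertex)
    (hu : {w : 𝒢.graph.Vertex | ∃ b b' : 𝒢.graph.Branch, 𝒢.graph.edgeOf b = 𝒢.graph.edgeOf b' ∧
      𝒢.graph.abuts b = some u ∧ 𝒢.graph.abuts b' = some w}.Finite)
    (hpers : ∀ k : D.J, ∃ y : (D.tree k).Vertex, (D.proj k).vertexMap y = u ∧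
      ∀ g ∈ C, (D.act k g).hom.vertexMap y = y) :
    ∃ (v : 𝒢.graph.Vertex) (H : Subgroup c.G), H ∈ verticialSubgroups c v ∧ C ≤ H := by
  obtain ⟨x, hx, hfx⟩ := D.exists_fixedSystem_of_persistent C hLE hlocfin u hu hpers
  obtain ⟨v, H, hH, hst⟩ := D.stab x hx
  exact ⟨v, H, hH, fun g hg => hst g fun j => hfx g hg j⟩

/-- **A subgroup in a verticial subgroup has a persistent base vertex** (the easy converse, valid over any
level data): by (I1) the verticial subgroup fixes a compatible vertex system, whose members lie over one base
vertex. [cite: MochizukiSemiAnbd2006, Thm 3.7(iii) p.41] -/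
theorem exists_persistent_of_le_verticial (C : Subgroup c.G) {v : 𝒢.graph.Vertex} {H : Subgroup c.G}
    (hH : H ∈ verticialSubgroups c v) (hCH : C ≤ H) :
    ∃ u : 𝒢.graph.Vertex, ∀ k : D.J, ∃ y : (D.tree k).Vertex, (D.proj k).vertexMap y = u ∧
      ∀ g ∈ C, (D.act k g).hom.vertexMap y = y := by
  obtain ⟨x, hx, hfx⟩ := D.fix v H hH
  obtain ⟨j₀⟩ := D.nonempty
  refine ⟨(D.proj j₀).vertexMap (x j₀), fun k => ⟨x k, ?_, fun g hg => hfx g (hCH hg) k⟩⟩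
  obtain ⟨m, hkm, hj₀m⟩ := exists_ge_ge k j₀
  rw [← hx hkm, ← hx hj₀m, ← D.proj_eq_proj_trans hkm, ← D.proj_eq_proj_trans hj₀m]

/-- **A persistent vertex from a finite set met at every level** (pigeonhole along the directed index order):
if every level carries a `C`-fixed vertex over the FINITE set `S` of base vertices, then some `u ∈ S` carries
one at every level — no fixed vertex over `u` at one level means none at all deeper levels (transitions
preserve fixed vertices and base vertices), so finitely many non-persistent vertices are simultaneously
avoided from one level on. [cite: MochizukiSemiAnbd2006, Thm 3.7(iii) p.41] -/
theorem exists_persistent_of_finite (C : Subgroup c.G) (S : Set 𝒢.graph.Vertex) (hS : S.Finite)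
    (hall : ∀ k : D.J, ∃ y : (D.tree k).Vertex, (D.proj k).vertexMap y ∈ S ∧
      ∀ g ∈ C, (D.act k g).hom.vertexMap y = y) :
    ∃ u ∈ S, ∀ k : D.J, ∃ y : (D.tree k).Vertex, (D.proj k).vertexMap y = u ∧
      ∀ g ∈ C, (D.act k g).hom.vertexMap y = y := by
  classical
  by_contra hnp
  push Not at hnp
  have hnp' : ∀ u : S, ∃ k : D.J, ∀ (k' : D.J), k ≤ k' → ∀ y : (D.tree k').Vertex,
      (D.proj k').vertexMap y = u → ∃ g ∈ C, (D.act k' g).hom.vertexMap y ≠ y := by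
    intro u
    obtain ⟨k, hk⟩ := hnp u u.2
    refine ⟨k, fun k' hkk' y hyu => ?_⟩
    by_contra hfy
    push Not at hfy
    obtain ⟨g, hg, hne⟩ := hk ((D.trans hkk').vertexMap y) (by rw [← D.proj_eq_proj_trans hkk', hyu])
    exact hne (D.fixed_trans C hkk' y hfy g hg)
  choose kf hkf using hnp'
  haveI : Finite S := hS.to_subtype
  obtain ⟨K, hK⟩ := (Set.finite_range kf).bddAbove
  obtain ⟨y, hyS, hfy⟩ := hall K
  obtain ⟨g, hg, hne⟩ := hkf ⟨_, hyS⟩ K (hK ⟨⟨_, hyS⟩, rfl⟩) y rfl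
  exact hne (hfy g hg)

/-- **ESCAPE** ([SemiAnbd] Thm 3.7 (iii) p. 41, the shape of any failure of the existence sentence at a
locally finite base): under (LE_C,w) everywhere, finite stars of the trees and of the base vertices, if `C`
lies in NO verticial subgroup then for every FINITE set `S` of base vertices some level `𝒢_{∞,k}` carries no
`C`-fixed vertex over `S` (else some `u ∈ S` is persistent, `exists_persistent_of_finite`, contradicting
`exists_verticial_ge_of_persistent`). [cite: MochizukiSemiAnbd2006, Thm 3.7(iii) pp.40-41] -/
theorem exists_level_forall_not_fixed_of_forall_not_le (C : Subgroup c.G)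
    (hLE : ∀ (w : 𝒢.graph.Vertex) (j : D.J), ∃ (k : D.J) (hjk : j ≤ k), ∀ (k' : D.J) (hkk' : k ≤ k')
      (v : (D.tree k').Vertex), (D.proj k').vertexMap v = w →
      ∀ (b b' : (D.tree k').Branch), (D.tree k').abuts b = some v → (D.tree k').abuts b' = some v →
      (D.tree k').edgeOf b ≠ (D.tree k').edgeOf b' →
      (∀ g ∈ C, (D.act k' g).hom.edgeMap ((D.tree k').edgeOf b) = (D.tree k').edgeOf b) →
      (∀ g ∈ C, (D.act k' g).hom.edgeMap ((D.tree k').edgeOf b') = (D.tree k').edgeOf b') →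
      (D.trans (hjk.trans hkk')).edgeMap ((D.tree k').edgeOf b) =
        (D.trans (hjk.trans hkk')).edgeMap ((D.tree k').edgeOf b'))
    (hlocfin : ∀ (j : D.J) (x : (D.tree j).Vertex), {b : (D.tree j).Branch | (D.tree j).abuts b = some x}.Finite)
    (hN : ∀ u : 𝒢.graph.Vertex, {w : 𝒢.graph.Vertex | ∃ b b' : 𝒢.graph.Branch,
      𝒢.graph.edgeOf b = 𝒢.graph.edgeOf b' ∧ 𝒢.graph.abuts b = some u ∧ 𝒢.graph.abuts b' = some w}.Finite)
    (hnot : ∀ (v : 𝒢.graph.Vertex) (H : Subgroup c.G), H ∈ verticialSubgroups c v → ¬ C ≤ H)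
    (S : Set 𝒢.graph.Vertex) (hS : S.Finite) :
    ∃ k : D.J, ∀ y : (D.tree k).Vertex, (D.proj k).vertexMap y ∈ S →
      ∃ g ∈ C, (D.act k g).hom.vertexMap y ≠ y := by
  by_contra hcon
  push Not at hcon
  obtain ⟨u, -, hpers⟩ := D.exists_persistent_of_finite C S hS hcon
  obtain ⟨v, H, hH, hCH⟩ := D.exists_verticial_ge_of_persistent C hLE hlocfin u (hN u) hpers
  exact hnot v H hH hCH

end VerticialLevelData

end ProfiniteSemiGraph

end Literature.AnabelianGeometry.SemiGraphs
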